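import Summits.QuantumFields.GaugeBoot.AdInvariantSchwingerDysonRowsUnitary
import Literature.Barriers.QuantumFields.ToronPlaneAnticorrelationProof
import Mathlib.MeasureTheory.Group.Integral
import HarnessLib

/-!
# Schur averages of dressed line entries; the gauge group's Haar measure is the product measure (gauge-boot, L1 supplement)

HONEST FRAMING (cell `pub-gaugeboot`, page 1 of every file): the venture produces certified bounds
on lattice expectations at stated coupling, gauge group, dimension and torus size; NOT a mass gap,
NOT a continuum limit, NOT a string tension; NOT Yang–Mills-summit-bearing (barriers
`FixedCouplingUltralocality`, `PerturbativeInvisibility`). Structural; it certifies no number.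

Haar bookkeeping for `WilsonLineGramPositivity.lean`, from the Schur second moments
`∫ ρ(g)_{ai} conj ρ(g)_{bk} dg = δ_{ab} δ_{ik}/N` of a unitary lattice representation
(`HasSchurMoments`; `SU(N)`, `U(N)` — `hasSchurMoments_suN` / `_uN`):

* `integral_mul_rho_inv_apply_mul_conj` — right average `∫ (M ρ(h)⁻¹)_{cb} conj (M' ρ(h)⁻¹)_{c'b} dh
  = N⁻¹ (M M'ᴴ)_{cc'}`; `integral_rho_mul_mul_rho_inv_apply` — conjugation average
  `∫ (ρ(g) X ρ(g)⁻¹)_{aa'} dg = δ_{aa'} tr X / N`; ★ `integral_integral_line_pair` —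
  `∫∫ (ρ(g) H ρ(h)⁻¹)_{ab} conj (ρ(g) H' ρ(h)⁻¹)_{ab} dh dg = N⁻² tr (H H'ᴴ)`;
* `haarProbability_pi` — the Haar probability measure of a finite product of compact groups is the
  product of the Haar probability measures (uniqueness); `integral_gaugeGroup_pair` — over the gauge
  group `(ℤ/L)^d → G`, a function of `(γ x, γ y)` with `x ≠ y` integrates as an iterated Haar integral.

References: M. Creutz, *Quarks, gluons and lattices* (1983) (8.19)–(8.20); folklore.
-/

noncomputable section

open MeasureTheory
open scoped ComplexConjugate Matrix
open Literature.MathematicalPhysics.QuantumFieldTheory (haarProbability Site LatticeRep)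

namespace Summit.QuantumFields.GaugeBoot

variable {G : Type*} [Group G] [TopologicalSpace G] [IsTopologicalGroup G] [CompactSpace G]
  [MeasurableSpace G] [BorelSpace G] [SecondCountableTopology G] (r : LatticeRep G)

/-! ## Schur averages -/

section Schur

variable {r}

omit [SecondCountableTopology G] in
/-- **Right Schur average**: `∫ (M ρ(h)⁻¹)_{cb} conj (M' ρ(h)⁻¹)_{c'b} dh = N⁻¹ (M M'ᴴ)_{cc'}`. -/
theorem integral_mul_rho_inv_apply_mul_conj (hr : HasSchurMoments r)
    (M M' : Matrix (Fin r.N) (Fin r.N) ℂ) (c c' b : Fin r.N) :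
    ∫ h, (M * r.ρ h⁻¹) c b * conj ((M' * r.ρ h⁻¹) c' b) ∂haarProbability G =
      ((r.N : ℂ))⁻¹ * (M * M'ᴴ) c c' := by
  have hexp : (fun h => (M * r.ρ h⁻¹) c b * conj ((M' * r.ρ h⁻¹) c' b)) =
      fun h => ∑ e, ∑ e', M c e * conj (M' c' e') * (r.ρ h b e' * conj (r.ρ h b e)) := by
    funext h
    have h1 : (M * r.ρ h⁻¹) c b = ∑ e, M c e * conj (r.ρ h b e) := by
      simp only [Matrix.mul_apply, rho_inv_apply]
    have h2 : conj ((M' * r.ρ h⁻¹) c' b) = ∑ e', conj (M' c' e') * r.ρ h b e' := by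
      simp only [Matrix.mul_apply, rho_inv_apply, map_sum, map_mul, Complex.conj_conj]
    rw [h1, h2, Finset.sum_mul_sum]
    refine Finset.sum_congr rfl fun e _ => Finset.sum_congr rfl fun e' _ => ?_
    ring
  have hI : ∀ e e', Integrable (fun h => M c e * conj (M' c' e') * (r.ρ h b e' * conj (r.ρ h b e)))
      (haarProbability G) := fun e e' => by
    refine Continuous.integrable_of_hasCompactSupport ?_ (HasCompactSupport.of_compactSpace _)
    exact continuous_const.mul ((r.continuous.matrix_elem b e').mul
      (Complex.continuous_conj.comp (r.continuous.matrix_elem b e)))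
  have hee : ∀ e e', ∫ h, M c e * conj (M' c' e') * (r.ρ h b e' * conj (r.ρ h b e)) ∂haarProbability G =
      M c e * conj (M' c' e') * (if e' = e then ((r.N : ℂ))⁻¹ else 0) := fun e e' => by
    rw [integral_const_mul, hr]
    by_cases h : e' = e
    · rw [if_pos ⟨rfl, h⟩, if_pos h]
    · rw [if_neg (fun h' => h h'.2), if_neg h]
  rw [hexp, integral_finsetSum _ fun e _ => integrable_finsetSum _ fun e' _ => hI e e']
  have he : ∀ e, ∫ h, ∑ e', M c e * conj (M' c' e') * (r.ρ h b e' * conj (r.ρ h b e)) ∂haarProbability G =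
      M c e * conj (M' c' e) * ((r.N : ℂ))⁻¹ := fun e => by
    rw [integral_finsetSum _ fun e' _ => hI e e', Finset.sum_congr rfl fun e' _ => hee e e',
      Finset.sum_eq_single_of_mem e (Finset.mem_univ e) fun e' _ he' => by rw [if_neg he', mul_zero],
      if_pos rfl]
  rw [Finset.sum_congr rfl fun e _ => he e, Matrix.mul_apply, Finset.mul_sum]
  refine Finset.sum_congr rfl fun e _ => ?_
  rw [Matrix.conjTranspose_apply, Complex.star_def]
  ring

omit [SecondCountableTopology G] in
/-- **Conjugation Schur average**: `∫ (ρ(g) X ρ(g)⁻¹)_{aa'} dg = δ_{aa'} tr X / N`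
(`integral_conj_apply` and inversion invariance of Haar measure). -/
theorem integral_rho_mul_mul_rho_inv_apply (hr : HasSchurMoments r) (X : Matrix (Fin r.N) (Fin r.N) ℂ)
    (a a' : Fin r.N) :
    ∫ g, (r.ρ g * X * r.ρ g⁻¹) a a' ∂haarProbability G =
      if a = a' then ((r.N : ℂ))⁻¹ * X.trace else 0 := by
  have h2 : (fun g : G => (r.ρ g * X * r.ρ g⁻¹) a a') =
      fun g => (fun k : G => (r.ρ k⁻¹ * X * r.ρ k) a a') g⁻¹ := by
    funext g
    simp only [inv_inv]
  rw [h2, MeasureTheory.integral_inv_eq_self (fun k : G => (r.ρ k⁻¹ * X * r.ρ k) a a')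
    (haarProbability G)]
  exact integral_conj_apply hr X a a'

omit [SecondCountableTopology G] in
/-- ★★ **Double Schur average of a pair of dressed line entries**:
`∫∫ (ρ(g) H ρ(h)⁻¹)_{ab} conj (ρ(g) H' ρ(h)⁻¹)_{ab} dh dg = N⁻² tr (H H'ᴴ)`. -/
theorem integral_integral_line_pair (hr : HasSchurMoments r) (H H' : Matrix (Fin r.N) (Fin r.N) ℂ)
    (a b : Fin r.N) :
    ∫ g, ∫ h, (r.ρ g * H * r.ρ h⁻¹) a b * conj ((r.ρ g * H' * r.ρ h⁻¹) a b)
        ∂haarProbability G ∂haarProbability G = ((r.N : ℂ))⁻¹ ^ 2 * (H * H'ᴴ).trace := by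
  have hinv : ∀ g : G, r.ρ g⁻¹ = (r.ρ g)ᴴ := fun g =>
    Matrix.ext fun i j => by rw [rho_inv_apply, Matrix.conjTranspose_apply, Complex.star_def]
  have inner : ∀ g, ∫ h, (r.ρ g * H * r.ρ h⁻¹) a b * conj ((r.ρ g * H' * r.ρ h⁻¹) a b)
      ∂haarProbability G = ((r.N : ℂ))⁻¹ * (r.ρ g * (H * H'ᴴ) * r.ρ g⁻¹) a a := fun g => by
    rw [integral_mul_rho_inv_apply_mul_conj hr (r.ρ g * H) (r.ρ g * H') a a b,
      Matrix.conjTranspose_mul, ← hinv, Matrix.mul_assoc, Matrix.mul_assoc, Matrix.mul_assoc]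
  rw [show (fun g => ∫ h, (r.ρ g * H * r.ρ h⁻¹) a b * conj ((r.ρ g * H' * r.ρ h⁻¹) a b)
      ∂haarProbability G) = fun g => ((r.N : ℂ))⁻¹ * (r.ρ g * (H * H'ᴴ) * r.ρ g⁻¹) a a from funext inner,
    integral_const_mul, integral_rho_mul_mul_rho_inv_apply hr, if_pos rfl]
  ring

end Schur

/-! ## The gauge group of the torus: product Haar measure -/

section GaugeGroup

/-- **The Haar probability measure of a finite product of compact groups is the product of the Haar
probability measures** (uniqueness of Haar measure). -/
theorem haarProbability_pi (ι : Type*) [Fintype ι] :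
    haarProbability (ι → G) = Measure.pi fun _ : ι => haarProbability G := by
  have h := Measure.haarMeasure_unique (Measure.pi fun _ : ι => haarProbability G)
    (⊤ : TopologicalSpace.PositiveCompacts (ι → G))
  rw [TopologicalSpace.PositiveCompacts.coe_top, measure_univ, one_smul] at h
  exact h.symm

variable {d L : ℕ} [NeZero L]

/-- ★ **A function of the gauge transformation at two distinct sites integrates over the gauge group
as an iterated Haar integral.** -/
theorem integral_gaugeGroup_pair {x y : Site d L} (hxy : x ≠ y) (F : G → G → ℂ)
    (hF : Continuous (Function.uncurry F)) :
    ∫ γ, F (γ x) (γ y) ∂haarProbability (Site d L → G) =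
      ∫ g, ∫ h, F g h ∂haarProbability G ∂haarProbability G := by
  rw [haarProbability_pi]
  have hm : AEMeasurable (fun γ : Site d L → G => (γ x, γ y))
      (Measure.pi fun _ : Site d L => haarProbability G) :=
    ((measurable_pi_apply x).prodMk (measurable_pi_apply y)).aemeasurable
  have h1 : ∫ γ, F (γ x) (γ y) ∂(Measure.pi fun _ : Site d L => haarProbability G) =
      ∫ z, Function.uncurry F z ∂((Measure.pi fun _ : Site d L => haarProbability G).map
        fun γ : Site d L → G => (γ x, γ y)) :=
    (integral_map hm hF.aestronglyMeasurable).symm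
  rw [h1, Literature.MathematicalPhysics.QuantumFieldTheory.ToronCumulant.map_eval_pair hxy,
    integral_prod _ (hF.integrable_of_hasCompactSupport (HasCompactSupport.of_compactSpace _))]
  rfl

end GaugeGroup

end Summit.QuantumFields.GaugeBoot

end
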